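import Mathlib

/-!
# Variants (sandwich semigroups)

[Ganyushkin–Mazorchuk 2009, §13.1 and Exercise 13.6.19].  For a semigroup `S` and `a ∈ S` the
*variant* `Sᵃ` is `S` with the sandwich operation `x ∘ₐ y = x a y`.  No new structure is
introduced here: statements about `Sᵃ` are spelled out with `x * a * y`, and "`Sᵃ ≅ T`" is
rendered as the existence of a bijection compatible with the two products.

* the sandwich operation is associative (`sandwich_assoc`);
* Proposition 13.1.1: (i) if `a` is a unit then `Sᵃ ≅ S` (`exists_equiv_sandwich_of_isUnit`,
  via `x ↦ x a`); (ii) for a monoid `S`, `Sᵃ ≅ S` iff `a` is a unit (`isUnit_iff_exists_equiv`);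
  Corollary 13.1.2: every variant of a group is isomorphic to the group
  (`exists_equiv_sandwich_group`);
* Proposition 13.1.3: `Sᵃ ≅ S^{uav}` for units `u, v` (`exists_equiv_sandwich_units`);
* Proposition 13.1.5: `x ↦ a x` (resp. `x ↦ x a`) is a homomorphism from `Sᵃ` onto `aS`
  (resp. `Sa`) (`mul_left_sandwich`, `mul_right_sandwich`), and for an idempotent `a` the
  sandwich product coincides with the product on `aS` and on `Sa`
  (`sandwich_eq_mul_of_idempotent_left/right`);
* Exercise 13.6.19: elements that are `𝓛`- (`𝓡`-, `𝓙`-) related in `Sᵃ` are already so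
  related in `S` (`greenL_of_sandwich`, `greenR_of_sandwich`, `greenJ_of_sandwich`).

## References
* [GanyushkinMazorchuk2009] O. Ganyushkin, V. Mazorchuk, *Classical Finite Transformation
  Semigroups. An Introduction*, Algebra and Applications 9, Springer, 2009, Chapter 13.
-/

namespace Literature.Algebra.Semigroups.Variant

variable {S : Type*}

/-- §13.1: the sandwich operation `x ∘ₐ y = x a y` is associative, so `Sᵃ = (S, ∘ₐ)` is a
semigroup. [cite: GanyushkinMazorchuk2009, §13.1] -/
theorem sandwich_assoc [Semigroup S] (a x y z : S) :
    (x * a * y) * a * z = x * a * (y * a * z) := by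
  simp only [mul_assoc]

/-- Proposition 13.1.1 (i): if `a ∈ S*` is invertible then `Sᵃ ≅ S`; concretely `y ↦ y a` is a
bijection with `(x ∘ₐ y) a = (x a)(y a)` (the inverse of the book's `x ↦ x a⁻¹`).
[cite: GanyushkinMazorchuk2009, Proposition 13.1.1 (i)] -/
theorem exists_equiv_sandwich_of_isUnit [Monoid S] {a : S} (ha : IsUnit a) :
    ∃ ψ : S ≃ S, ∀ x y, ψ (x * a * y) = ψ x * ψ y := by
  obtain ⟨u, rfl⟩ := ha
  refine ⟨⟨fun y => y * ↑u, fun x => x * ↑u⁻¹, fun y => ?_, fun x => ?_⟩, fun x y => ?_⟩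
  · simp
  · simp
  · simp [mul_assoc]

/-- Proposition 13.1.1 (ii): for a monoid `S`, `Sᵃ ≅ S` (a bijection `ψ` with
`ψ(x a y) = ψ(x) ψ(y)`) holds iff `a` is invertible: the identity `b` of `Sᵃ` gives `ab = ba = 1`.
[cite: GanyushkinMazorchuk2009, Proposition 13.1.1 (ii)] -/
theorem isUnit_iff_exists_equiv [Monoid S] (a : S) :
    (∃ ψ : S ≃ S, ∀ x y, ψ (x * a * y) = ψ x * ψ y) ↔ IsUnit a := by
  refine ⟨?_, exists_equiv_sandwich_of_isUnit⟩
  rintro ⟨ψ, hψ⟩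
  -- `b = ψ⁻¹ 1` is an identity element of `Sᵃ`
  set b := ψ.symm 1 with hb
  have h1 : ∀ s : S, s * a * b = s := fun s => ψ.injective (by rw [hψ, hb, ψ.apply_symm_apply, mul_one])
  have h2 : ∀ s : S, b * a * s = s := fun s => ψ.injective (by rw [hψ, hb, ψ.apply_symm_apply, one_mul])
  have hab : a * b = 1 := by simpa using h1 1
  have hba : b * a = 1 := by simpa using h2 1
  exact ⟨⟨a, b, hab, hba⟩, rfl⟩

/-- Corollary 13.1.2: every variant of a group `G` is isomorphic to `G`.
[cite: GanyushkinMazorchuk2009, Corollary 13.1.2] -/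
theorem exists_equiv_sandwich_group [Group S] (a : S) :
    ∃ ψ : S ≃ S, ∀ x y, ψ (x * a * y) = ψ x * ψ y :=
  exists_equiv_sandwich_of_isUnit (Group.isUnit a)

/-- Proposition 13.1.3: for a monoid `S`, `a ∈ S` and units `u, v`, `Sᵃ ≅ S^{uav}` via
`x ↦ v⁻¹ x u⁻¹`. [cite: GanyushkinMazorchuk2009, Proposition 13.1.3] -/
theorem exists_equiv_sandwich_units [Monoid S] (a : S) (u v : Sˣ) :
    ∃ φ : S ≃ S, ∀ x y, φ (x * a * y) = φ x * (↑u * a * ↑v) * φ y := by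
  refine ⟨⟨fun x => ↑v⁻¹ * x * ↑u⁻¹, fun y => ↑v * y * ↑u, fun x => ?_, fun y => ?_⟩,
    fun x y => ?_⟩
  · simp [mul_assoc]
  · simp [mul_assoc]
  · simp [mul_assoc]

/-- Proposition 13.1.5 (i): `φₗ : x ↦ a x` is a homomorphism from `Sᵃ` to `aS`:
`a (x ∘ₐ y) = (a x)(a y)` (it is onto `aS` by definition).
[cite: GanyushkinMazorchuk2009, Proposition 13.1.5 (i)] -/
theorem mul_left_sandwich [Semigroup S] (a x y : S) : a * (x * a * y) = (a * x) * (a * y) := by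
  simp only [mul_assoc]

/-- Proposition 13.1.5 (ii): `φᵣ : x ↦ x a` is a homomorphism from `Sᵃ` to `Sa`:
`(x ∘ₐ y) a = (x a)(y a)`. [cite: GanyushkinMazorchuk2009, Proposition 13.1.5 (ii)] -/
theorem mul_right_sandwich [Semigroup S] (a x y : S) : (x * a * y) * a = (x * a) * (y * a) := by
  simp only [mul_assoc]

/-- Proposition 13.1.5 (iii): if `a` is an idempotent, the sandwich operation `∘ₐ` coincides with
the multiplication on `aS`: `(a s) ∘ₐ (a t) = (a s)(a t)`.
[cite: GanyushkinMazorchuk2009, Proposition 13.1.5 (iii)] -/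
theorem sandwich_eq_mul_of_idempotent_left [Semigroup S] {a : S} (ha : a * a = a) (s t : S) :
    (a * s) * a * (a * t) = (a * s) * (a * t) := by
  simp only [mul_assoc]
  rw [← mul_assoc a a t, ha]

/-- Proposition 13.1.5 (iv): if `a` is an idempotent, `∘ₐ` coincides with the multiplication on
`Sa`: `(s a) ∘ₐ (t a) = (s a)(t a)`. [cite: GanyushkinMazorchuk2009, Proposition 13.1.5 (iv)] -/
theorem sandwich_eq_mul_of_idempotent_right [Semigroup S] {a : S} (ha : a * a = a) (s t : S) :
    (s * a) * a * (t * a) = (s * a) * (t * a) := by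
  rw [mul_assoc s a a, ha]

/-- Exercise 13.6.19 (`𝓛`): if `x = u ∘ₐ y` in `Sᵃ` then `x ∈ S y`; hence elements
`𝓛`-related in `Sᵃ` are `𝓛`-related in `S`. [cite: GanyushkinMazorchuk2009, Exercise 13.6.19] -/
theorem greenL_of_sandwich [Semigroup S] {a x y : S}
    (h : (x = y ∨ ∃ u, x = u * a * y) ∧ (y = x ∨ ∃ v, y = v * a * x)) :
    (x = y ∨ ∃ u, x = u * y) ∧ (y = x ∨ ∃ v, y = v * x) := by
  obtain ⟨h1, h2⟩ := h
  refine ⟨h1.imp id ?_, h2.imp id ?_⟩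
  · rintro ⟨u, rfl⟩
    exact ⟨u * a, rfl⟩
  · rintro ⟨v, rfl⟩
    exact ⟨v * a, rfl⟩

/-- Exercise 13.6.19 (`𝓡`): elements `𝓡`-related in `Sᵃ` are `𝓡`-related in `S`.
[cite: GanyushkinMazorchuk2009, Exercise 13.6.19] -/
theorem greenR_of_sandwich [Semigroup S] {a x y : S}
    (h : (x = y ∨ ∃ u, x = y * a * u) ∧ (y = x ∨ ∃ v, y = x * a * v)) :
    (x = y ∨ ∃ u, x = y * u) ∧ (y = x ∨ ∃ v, y = x * v) := by
  obtain ⟨h1, h2⟩ := h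
  refine ⟨h1.imp id ?_, h2.imp id ?_⟩
  · rintro ⟨u, rfl⟩
    exact ⟨a * u, (mul_assoc _ _ _)⟩
  · rintro ⟨v, rfl⟩
    exact ⟨a * v, (mul_assoc _ _ _)⟩

/-- Exercise 13.6.19 (`𝓙`): if `x = u ∘ₐ y ∘ₐ v` in `Sᵃ` then `x ∈ S y S`; together with the
`𝓛` and `𝓡` cases this shows that elements `𝓙`-related (and hence `𝓗`-, `𝓓`-related) in `Sᵃ`
are so related in `S`. [cite: GanyushkinMazorchuk2009, Exercise 13.6.19] -/
theorem greenJ_of_sandwich [Semigroup S] {a x y u v : S} (h : x = u * a * y * a * v) :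
    ∃ u' v', x = u' * y * v' :=
  ⟨u * a, a * v, by rw [h]; simp only [mul_assoc]⟩

end Literature.Algebra.Semigroups.Variant
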